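/-
Copyright (c) 2026 the pub-hodgecm-mathlib formalisation cell (harness21).  Prover seat hodgecm-mathlib-K2E1-p11 (g4), Track B ∕ K2-LIT, h413 = `stmt-HodgeConjecture-24833`,
R90-TF section S8 «ContSpec-n½», #2 road (G side), S8 dealer R90-CS-plan (g3) S8-R173 «ROW NORM» ∕ S8-R178 (2): FILE 3c-E — THE SECTION OF RECORD.  The last row `x` of every `g ∈ U(J₃)_w`
is `J₃`-ISOTROPIC (`x₂x̄₀ + |x₁|² + x₀x̄₂ = 0`: flip `gᴴ J g = J` into `g J gᴴ = J` and read entry `(2,2)`), so `|x₂ − x₀|² = |x₀|² + |x₁|² + |x₂|²`: the Euclidean vanishing factor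
`ρ_E ≡ 1` and `ℓ(a)_w ≠ 0` EVERYWHERE on `G_∞`.  Hence `archSectionE = Θ(ℓ)·χ₂⟨det⟩` (★ ED. 3, p863839) is a pure phase, CONTINUOUS WITHOUT ANY UNITARITY HYPOTHESIS, Borel-equivariant
(★ 3a) with `Φa(1) = 1`, and the (V) row (i) witness `∃ K′ ω φ, φ ∈ chiSectionSpacePair χ₁ χ₂ K′ ω ∧ Continuous φ ∧ φ 1 ≠ 0` holds for EVERY pair `(χ₁, χ₂)` (★ GLUE p863433 ∘ ★ finite
level section p863484 ∘ ★ conductor level p863810).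
-/
import Summits.HodgeConjecture.HodgeConjecture.Theorems.R90S8ChiSectionPairConductorLevelU3   -- ★ (this seat) 2b: `exists_isOpen_level_borelPairChar_eq_one`; brings ★ 3c ∕ 3b ∕ 3a ∕ Defs (ED. 3) ∕ FILE 2 ∕ FILE 1
import Literature.NumberTheory.Automorphic.UnitaryGroupArchimedeanPlaces                    -- ★ `mem_arch_iff_forall`, `archLocal`, `mem_archLocal_iff_conjTranspose`
import HarnessLib

/-!
# S8 #2 road (G side) — `R90S8ChiSectionPairArchSectionWitnessEU3`: `J₃`-isotropy of the last row, `ρ_E ≡ 1`, and THE HYPOTHESIS-FREE NON-ZERO `(χ₁,χ₂)`-SECTION OF RECORD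

WHAT THIS FILE DOES (vocabulary: ★ ED. 3 `archRowFactorE`, `archSectionE`; ★ `archLastRow`, `archLastRowL` (`ℓ = x₂ − x₀`); ★ `arch`, `archLocal`, `evalC`; ★ `chiSectionSpacePair`).
* §1 `antidiagonal_three_over_apply`, `antidiagonal_three_over_mul_self`; **`archRow_isotropic`**: at a complex place `w`, with `z_j := (ι_∞ a)₂ⱼ` read in `ℂ` (`evalC`), `z₂ z̄₀ + z₁ z̄₁ + z₀ z̄₂ = 0`
  (★ `mem_arch_iff_forall` + ★ `mem_archLocal_iff_conjTranspose`, flipped by `mul_eq_one_comm`); `extensionEmbedding_archLastRow_fst` (the adele coordinate `(x_j)_w ∈ L_w` IS `z_j` under the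
  isometry `L_w →+* ℂ`); **`norm_sq_archLastRowL_fst`**: `‖ℓ(a)_w‖² = Σⱼ ‖(x_j)_w‖²`; `archLastRowL_fst_ne_zero`; **`archRowFactorE_eq_one`**; `archSectionE_eq` (`Φa = Θ(ℓ)·χ₂⟨det⟩`).
* §2 **`continuous_archSectionE`** — NO unitarity: `a ↦ (ℓ(a), ((ℓ(a)_w⁻¹)_w, 1))` is a continuous IDELE-valued map on all of `G_∞` (★ 3b `continuous_lastRowChar_units_comp`).
* §3 `archSectionE_archPart_mul` (`hΦaB`, ★ 3a multiplier lemma), `archSectionE_one` (`Φa(1) = 1`).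
* §4 **`exists_chiSectionPair_continuous_apply_one_ne_zero_of_level_E`** and the HYPOTHESIS-FREE **`exists_chiSectionPair_continuous_apply_one_ne_zero_E (χ₁ χ₂) :
  ∃ K′ ω φ, φ ∈ chiSectionSpacePair χ₁ χ₂ K′ ω ∧ Continuous φ ∧ φ 1 ≠ 0`** (★ p863433 GLUE with `Φa := archSectionE`, ★ p863484 `Φf`, ★ p863810 conductor level).
HONEST LABEL: HC_CM is proved only modulo the 7 printed citations (2 remaining named inputs: hLiu418 = `stmt-HodgeConjecture-24832`, h413 = `stmt-HodgeConjecture-24833`) until rung 0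
closes; REL ≠ ★ ≠ BUILT; this file asserts no named fact and closes no socket — (V) row (i) consumers read §4 BY NAME; count-neutral.

## References
* [BorelJacquet1979] A. Borel, H. Jacquet, *Automorphic forms and automorphic representations*, Corvallis PSPM 33.1 (1979), §4.1.
* [Rogawski1990] J. D. Rogawski, *Automorphic Representations of Unitary Groups in Three Variables* (1990), §1.9–§1.10 (the form `J₃`, the Borel, isotropic vectors).
* [MoeglinWaldspurger1995] C. Mœglin, J.-L. Waldspurger, *Spectral Decomposition and Eisenstein Series* (1995), I.2.17.
-/

set_option autoImplicit false
set_option linter.dupNamespace false  -- the mandated namespace `…HodgeConjecture.HodgeConjecture.R90.S8` (LEAD #1 L1) repeats the summit's segment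

noncomputable section

open NumberField IsDedekindDomain Topology Filter ComplexConjugate
open scoped Matrix
open Literature.NumberTheory.Automorphic Literature.NumberTheory.Automorphic.UnitaryGroup Literature.NumberTheory.GaloisRepresentations AdelicGroupData
open Literature.NumberTheory.Automorphic.Arthur2013.Leaves.TECR
open Literature.NumberTheory.Automorphic.UnitaryGroup.AdelicCharactersDetQuasiSplit (antidiagonal_over_det_ne_zero)
open Summit.HodgeConjecture.HodgeConjecture.Cruxes.H413.K2E1CharacterEisensteinU2Defs
open Summit.HodgeConjecture.HodgeConjecture.Cruxes.H413.K2E1CharacterEisensteinU3PairDefs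
open Summit.HodgeConjecture.HodgeConjecture.Cruxes.H413.K2E1ChiSectionSpaceU3PairDefs

namespace Summit.HodgeConjecture.HodgeConjecture.R90.S8

variable (L : Type) [Field L] [NumberField L] [IsCMField L]

/-! ## §1 `J₃`-isotropy of the last row; `ρ_E ≡ 1` -/

omit [NumberField L] [IsCMField L] in
/-- Entries of `J₃ = antidiag(1,1,1)` over `ℂ`. [cite: Rogawski1990, §1.9] -/
theorem antidiagonal_three_over_apply (i j : Fin 3) : (StdForm.antidiagonal 3).over ℂ i j = if j = i.rev then 1 else 0 := by
  rw [StdForm.over, Matrix.map_apply, StdForm.antidiagonal_J_apply]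
  split_ifs <;> simp

omit [NumberField L] [IsCMField L] in
/-- `J₃ · J₃ = 1`. [cite: Rogawski1990, §1.9] -/
theorem antidiagonal_three_over_mul_self : (StdForm.antidiagonal 3).over ℂ * (StdForm.antidiagonal 3).over ℂ = 1 := by
  rw [StdForm.over, ← Matrix.map_mul, (StdForm.antidiagonal 3).mul_self, Matrix.map_one _ (map_zero _) (map_one _)]

omit [NumberField L] [IsCMField L] in
/-- `Mᴴ J M = J` with `J² = 1` flips to `M J Mᴴ = J` (`J Mᴴ J` is a left, hence right, inverse of `M`). [cite: Rogawski1990, §1.9] -/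
theorem mul_form_mul_conjTranspose_eq {M J : Matrix (Fin 3) (Fin 3) ℂ} (hJ : J * J = 1) (h : Mᴴ * J * M = J) : M * J * Mᴴ = J := by
  have h1 : (J * Mᴴ * J) * M = 1 := by
    calc (J * Mᴴ * J) * M = J * (Mᴴ * J * M) := by simp only [Matrix.mul_assoc]
      _ = 1 := by rw [h, hJ]
  have h2 : M * (J * Mᴴ * J) = 1 := mul_eq_one_comm.1 h1
  calc M * J * Mᴴ = M * J * Mᴴ * (J * J) := by rw [hJ, Matrix.mul_one]
    _ = (M * (J * Mᴴ * J)) * J := by simp only [Matrix.mul_assoc]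
    _ = J := by rw [h2, Matrix.one_mul]

/-- **THE LAST ROW IS `J₃`-ISOTROPIC**: for `a ∈ G_∞ = U(J₃)(L ⊗ ℝ)` and a (complex) place `w`, with `z_j := ((a)₂ⱼ)_w ∈ ℂ`: `z₂ z̄₀ + z₁ z̄₁ + z₀ z̄₂ = 0` (`a_wᴴ J₃ a_w = J₃` ⇒ `a_w J₃ a_wᴴ = J₃`,
entry `(2,2)`; `(J₃)₂₂ = 0`). [cite: Rogawski1990, §1.9] -/
theorem archRow_isotropic (a : arch (↥(maximalRealSubfield L)) L (IsCMField.complexConj L) 3 ((StdForm.antidiagonal 3).over L)) (w : InfinitePlace L) :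
    evalC L ⟨w, IsTotallyComplex.isComplex w⟩ (((a : GL (Fin 3) (mixedEmbedding.mixedSpace L)) : Matrix (Fin 3) (Fin 3) (mixedEmbedding.mixedSpace L)) 2 2) *
        conj (evalC L ⟨w, IsTotallyComplex.isComplex w⟩ (((a : GL (Fin 3) (mixedEmbedding.mixedSpace L)) : Matrix (Fin 3) (Fin 3) (mixedEmbedding.mixedSpace L)) 2 0)) +
      evalC L ⟨w, IsTotallyComplex.isComplex w⟩ (((a : GL (Fin 3) (mixedEmbedding.mixedSpace L)) : Matrix (Fin 3) (Fin 3) (mixedEmbedding.mixedSpace L)) 2 1) *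
        conj (evalC L ⟨w, IsTotallyComplex.isComplex w⟩ (((a : GL (Fin 3) (mixedEmbedding.mixedSpace L)) : Matrix (Fin 3) (Fin 3) (mixedEmbedding.mixedSpace L)) 2 1)) +
      evalC L ⟨w, IsTotallyComplex.isComplex w⟩ (((a : GL (Fin 3) (mixedEmbedding.mixedSpace L)) : Matrix (Fin 3) (Fin 3) (mixedEmbedding.mixedSpace L)) 2 0) *
        conj (evalC L ⟨w, IsTotallyComplex.isComplex w⟩ (((a : GL (Fin 3) (mixedEmbedding.mixedSpace L)) : Matrix (Fin 3) (Fin 3) (mixedEmbedding.mixedSpace L)) 2 2)) = 0 := by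
  set M : Matrix (Fin 3) (Fin 3) ℂ := (((a : GL (Fin 3) (mixedEmbedding.mixedSpace L)) : Matrix (Fin 3) (Fin 3) (mixedEmbedding.mixedSpace L))).map
    (evalC L ⟨w, IsTotallyComplex.isComplex w⟩) with hM
  have hmem := (mem_arch_iff_forall (↥(maximalRealSubfield L)) L (IsCMField.complexConj L) 3 ((StdForm.antidiagonal 3).over L)
    (IsCMField.complexConj_ne_one L) (complexConj_smul_infinitePlace L) (a : GL (Fin 3) (mixedEmbedding.mixedSpace L))).1 a.2 ⟨w, IsTotallyComplex.isComplex w⟩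
  rw [mem_archLocal_iff_conjTranspose, StdForm.over_map] at hmem
  have hM' : ((Matrix.GeneralLinearGroup.map (evalC L ⟨w, IsTotallyComplex.isComplex w⟩) (a : GL (Fin 3) (mixedEmbedding.mixedSpace L)) : GL (Fin 3) ℂ) : Matrix (Fin 3) (Fin 3) ℂ) = M := rfl
  rw [hM'] at hmem
  have hflip := mul_form_mul_conjTranspose_eq antidiagonal_three_over_mul_self hmem
  have h22 := congrFun (congrFun hflip 2) 2
  simp only [Matrix.mul_apply, Fin.sum_univ_three, Matrix.conjTranspose_apply, antidiagonal_three_over_apply, Complex.star_def] at h22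
  simp [Fin.rev, Fin.ext_iff] at h22
  show M 2 2 * conj (M 2 0) + M 2 1 * conj (M 2 1) + M 2 0 * conj (M 2 2) = 0
  linear_combination h22

/-- The `w`-coordinate of the mixed-space equivalence is the extension embedding: `(e y)_w = ι_w (y w)` (Mathlib `ringEquiv_mixedSpace_apply`). [folklore] -/
theorem ringEquiv_mixedSpace_snd_apply (y : InfiniteAdeleRing L) (w : InfinitePlace L) :
    ((InfiniteAdeleRing.ringEquiv_mixedSpace L) y).2 ⟨w, IsTotallyComplex.isComplex w⟩ = InfinitePlace.Completion.extensionEmbedding w (y w) := by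
  rw [InfiniteAdeleRing.ringEquiv_mixedSpace_apply]

/-- **The adele coordinate IS the complex coordinate**: `ι_w((x_j)_w) = z_j` for the isometric embedding `ι_w : L_w →+* ℂ`. [cite: BorelJacquet1979, §4.1] -/
theorem extensionEmbedding_archLastRow_fst (a : arch (↥(maximalRealSubfield L)) L (IsCMField.complexConj L) 3 ((StdForm.antidiagonal 3).over L)) (j : Fin 3) (w : InfinitePlace L) :
    InfinitePlace.Completion.extensionEmbedding w ((archLastRow L a j).1 w) =
      evalC L ⟨w, IsTotallyComplex.isComplex w⟩ (((a : GL (Fin 3) (mixedEmbedding.mixedSpace L)) : Matrix (Fin 3) (Fin 3) (mixedEmbedding.mixedSpace L)) 2 j) := by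
  rw [evalC_apply, archLastRow_def, adelicVal_archToAdelic, GLn.coe_ofInfinite_apply, ← ringEquiv_mixedSpace_snd_apply]
  simp only [RingEquiv.apply_symm_apply]

/-- `‖(x_j)_w‖ = ‖z_j‖` (`ι_w` is an isometry). [cite: BorelJacquet1979, §4.1] -/
theorem norm_archLastRow_fst (a : arch (↥(maximalRealSubfield L)) L (IsCMField.complexConj L) 3 ((StdForm.antidiagonal 3).over L)) (j : Fin 3) (w : InfinitePlace L) :
    ‖(archLastRow L a j).1 w‖ =
      ‖evalC L ⟨w, IsTotallyComplex.isComplex w⟩ (((a : GL (Fin 3) (mixedEmbedding.mixedSpace L)) : Matrix (Fin 3) (Fin 3) (mixedEmbedding.mixedSpace L)) 2 j)‖ := by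
  rw [← extensionEmbedding_archLastRow_fst, Isometry.norm_map_of_map_zero (InfinitePlace.Completion.isometry_extensionEmbedding w) (map_zero _)]

/-- `‖ℓ(a)_w‖ = ‖z₂ − z₀‖`. [cite: BorelJacquet1979, §4.1] -/
theorem norm_archLastRowL_fst (a : arch (↥(maximalRealSubfield L)) L (IsCMField.complexConj L) 3 ((StdForm.antidiagonal 3).over L)) (w : InfinitePlace L) :
    ‖(archLastRowL L a).1 w‖ =
      ‖evalC L ⟨w, IsTotallyComplex.isComplex w⟩ (((a : GL (Fin 3) (mixedEmbedding.mixedSpace L)) : Matrix (Fin 3) (Fin 3) (mixedEmbedding.mixedSpace L)) 2 2) -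
        evalC L ⟨w, IsTotallyComplex.isComplex w⟩ (((a : GL (Fin 3) (mixedEmbedding.mixedSpace L)) : Matrix (Fin 3) (Fin 3) (mixedEmbedding.mixedSpace L)) 2 0)‖ := by
  have h : (archLastRowL L a).1 w = (archLastRow L a 2).1 w - (archLastRow L a 0).1 w := rfl
  rw [h, ← Isometry.norm_map_of_map_zero (InfinitePlace.Completion.isometry_extensionEmbedding w) (map_zero _), map_sub,
    extensionEmbedding_archLastRow_fst, extensionEmbedding_archLastRow_fst]

/-- **`‖ℓ(a)_w‖² = Σⱼ ‖(x_j)_w‖²`** (`|z₂ − z₀|² = |z₀|² + |z₁|² + |z₂|²` from isotropy). [cite: Rogawski1990, §1.9] -/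
theorem norm_sq_archLastRowL_fst (a : arch (↥(maximalRealSubfield L)) L (IsCMField.complexConj L) 3 ((StdForm.antidiagonal 3).over L)) (w : InfinitePlace L) :
    ‖(archLastRowL L a).1 w‖ ^ 2 = ∑ j : Fin 3, ‖(archLastRow L a j).1 w‖ ^ 2 := by
  rw [Fin.sum_univ_three, norm_archLastRowL_fst, norm_archLastRow_fst, norm_archLastRow_fst, norm_archLastRow_fst]
  set z : Fin 3 → ℂ := fun j =>
    evalC L ⟨w, IsTotallyComplex.isComplex w⟩ (((a : GL (Fin 3) (mixedEmbedding.mixedSpace L)) : Matrix (Fin 3) (Fin 3) (mixedEmbedding.mixedSpace L)) 2 j) with hz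
  have hiso : z 2 * conj (z 0) + z 1 * conj (z 1) + z 0 * conj (z 2) = 0 := archRow_isotropic L a w
  show ‖z 2 - z 0‖ ^ 2 = ‖z 0‖ ^ 2 + ‖z 1‖ ^ 2 + ‖z 2‖ ^ 2
  have e : ∀ u : ℂ, ((‖u‖ ^ 2 : ℝ) : ℂ) = u * conj u := fun u => by
    rw [Complex.mul_conj, Complex.normSq_eq_norm_sq]
  apply Complex.ofReal_injective
  rw [Complex.ofReal_add, Complex.ofReal_add, e, e, e, e, map_sub]
  linear_combination (-1 : ℂ) * hiso

/-- `Σⱼ ‖(x_j)_w‖² > 0` (the archimedean row is non-zero, ★ `archLastRow_fst_ne_zero`). [cite: BorelJacquet1979, §4.1] -/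
theorem sum_norm_sq_archLastRow_fst_pos (a : arch (↥(maximalRealSubfield L)) L (IsCMField.complexConj L) 3 ((StdForm.antidiagonal 3).over L)) (w : InfinitePlace L) :
    0 < ∑ j : Fin 3, ‖(archLastRow L a j).1 w‖ ^ 2 := by
  obtain ⟨j, hj⟩ := Function.ne_iff.1 (archLastRow_fst_ne_zero L a w)
  have hle : ‖(archLastRow L a j).1 w‖ ^ 2 ≤ ∑ i : Fin 3, ‖(archLastRow L a i).1 w‖ ^ 2 :=
    Finset.single_le_sum (f := fun i : Fin 3 => ‖(archLastRow L a i).1 w‖ ^ 2) (fun i _ => sq_nonneg _) (Finset.mem_univ j)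
  exact lt_of_lt_of_le (pow_pos (norm_pos_iff.2 hj) 2) hle

/-- **`ℓ(a)_w ≠ 0` at every archimedean place.** [cite: Rogawski1990, §1.9] -/
theorem archLastRowL_fst_ne_zero (a : arch (↥(maximalRealSubfield L)) L (IsCMField.complexConj L) 3 ((StdForm.antidiagonal 3).over L)) (w : InfinitePlace L) :
    (archLastRowL L a).1 w ≠ 0 := by
  intro h
  have h2 := norm_sq_archLastRowL_fst L a w
  rw [h, norm_zero, zero_pow two_ne_zero] at h2
  exact (sum_norm_sq_archLastRow_fst_pos L a w).ne h2

/-- `√(Σⱼ ‖(x_j)_w‖²) = ‖ℓ(a)_w‖`. [cite: Rogawski1990, §1.9] -/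
theorem sqrt_sum_norm_sq_archLastRow_fst (a : arch (↥(maximalRealSubfield L)) L (IsCMField.complexConj L) 3 ((StdForm.antidiagonal 3).over L)) (w : InfinitePlace L) :
    Real.sqrt (∑ j : Fin 3, ‖(archLastRow L a j).1 w‖ ^ 2) = ‖(archLastRowL L a).1 w‖ := by
  rw [← norm_sq_archLastRowL_fst, Real.sqrt_sq (norm_nonneg _)]

/-- **`ρ_E ≡ 1` on `G_∞`.** [cite: Rogawski1990, §1.9] -/
theorem archRowFactorE_eq_one (a : arch (↥(maximalRealSubfield L)) L (IsCMField.complexConj L) 3 ((StdForm.antidiagonal 3).over L)) : archRowFactorE L a = 1 := by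
  rw [archRowFactorE_def]
  exact Finset.prod_eq_one fun w _ => by rw [sqrt_sum_norm_sq_archLastRow_fst, div_self (norm_ne_zero_iff.2 (archLastRowL_fst_ne_zero L a w))]

/-- **The section of record is the pure phase `Φa = Θ(ℓ)·χ₂⟨det⟩`.** [cite: Rogawski1990, §1.10] -/
theorem archSectionE_eq (χ₁ : HeckeCharacter L) (χ₂ : ↥(TorusDict.torus (IsCMField.complexConj L)) →ₜ* ℂˣ)
    (a : arch (↥(maximalRealSubfield L)) L (IsCMField.complexConj L) 3 ((StdForm.antidiagonal 3).over L)) :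
    archSectionE L χ₁ χ₂ a = lastRowChar L χ₁ χ₂ (archLastRowL L a) *
      ((adelicOneChar (↥(maximalRealSubfield L)) L (IsCMField.complexConj L) χ₂
        (adelicDet (↥(maximalRealSubfield L)) L (IsCMField.complexConj L) 3 ((StdForm.antidiagonal 3).over L) (antidiagonal_over_det_ne_zero L 3)
          (archToAdelic (↥(maximalRealSubfield L)) L (IsCMField.complexConj L) 3 ((StdForm.antidiagonal 3).over L) a)) : ℂˣ) : ℂ) := by
  rw [archSectionE_def, archRowFactorE_eq_one, Complex.ofReal_one, mul_one]

/-! ## §2 Continuity — no unitarity hypothesis -/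

/-- `a ↦ ℓ(a) ∈ 𝔸_Lˣ` is a CONTINUOUS IDELE-VALUED map on all of `G_∞` (finite part `1`, archimedean components never zero, explicit inverse `((ℓ_w⁻¹)_w, 1)`). [cite: BorelJacquet1979, §4.1] -/
theorem continuous_units_archLastRowL :
    Continuous fun a : arch (↥(maximalRealSubfield L)) L (IsCMField.complexConj L) 3 ((StdForm.antidiagonal 3).over L) =>
      (⟨archLastRowL L a, (fun w : InfinitePlace L => ((archLastRowL L a).1 w)⁻¹, (1 : FiniteAdeleRing (𝓞 L) L)),
        (mul_eq_one_of_fst_inv_of_snd_one L (archLastRowL L a) (fun w : InfinitePlace L => ((archLastRowL L a).1 w)⁻¹, (1 : FiniteAdeleRing (𝓞 L) L))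
          (archLastRowL_fst_ne_zero L a) (archLastRowL_snd L a) (fun _ => rfl) rfl).1,
        (mul_eq_one_of_fst_inv_of_snd_one L (archLastRowL L a) (fun w : InfinitePlace L => ((archLastRowL L a).1 w)⁻¹, (1 : FiniteAdeleRing (𝓞 L) L))
          (archLastRowL_fst_ne_zero L a) (archLastRowL_snd L a) (fun _ => rfl) rfl).2⟩ : (AdeleRing (𝓞 L) L)ˣ) :=
  Units.continuous_iff.2 ⟨continuous_archLastRowL L,
    (continuous_pi fun w => ((continuous_apply w).comp (continuous_fst.comp (continuous_archLastRowL L))).inv₀ fun a => archLastRowL_fst_ne_zero L a w).prodMk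
      continuous_const⟩

/-- **`Φa = archSectionE χ₁ χ₂` IS CONTINUOUS on `G_∞` — for EVERY pair `(χ₁, χ₂)`** (composition of continuous maps: ★ 3b `continuous_lastRowChar_units_comp` along the idele-valued `ℓ`, times the
determinant character). [cite: BorelJacquet1979, §4.1] [cite: Rogawski1990, §1.10] -/
theorem continuous_archSectionE (χ₁ : HeckeCharacter L) (χ₂ : ↥(TorusDict.torus (IsCMField.complexConj L)) →ₜ* ℂˣ) : Continuous (archSectionE L χ₁ χ₂) := by
  have h : archSectionE L χ₁ χ₂ = fun a => lastRowChar L χ₁ χ₂ (archLastRowL L a) *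
      ((adelicOneChar (↥(maximalRealSubfield L)) L (IsCMField.complexConj L) χ₂
        (adelicDet (↥(maximalRealSubfield L)) L (IsCMField.complexConj L) 3 ((StdForm.antidiagonal 3).over L) (antidiagonal_over_det_ne_zero L 3)
          (archToAdelic (↥(maximalRealSubfield L)) L (IsCMField.complexConj L) 3 ((StdForm.antidiagonal 3).over L) a)) : ℂˣ) : ℂ) := funext (archSectionE_eq L χ₁ χ₂)
  rw [h]
  exact (continuous_lastRowChar_units_comp L χ₁ χ₂ (continuous_units_archLastRowL L)).mul (continuous_adelicOneChar_adelicDet_archToAdelic L χ₂)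

/-! ## §3 Borel equivariance and the value at `1` -/

/-- **`Φa(b_∞·a) = χ₁((b_∞)₀₀)·χ₂((b_∞)₁₁)·Φa(a)`** for the section of record — the letter `hΦaB` of ★ p863433 (★ 3a `lastRowChar_borel_mul_mul_adelicDet` with `y := ℓ(a)`, ★ 3c `archLastRowL_archPart_mul`).
[cite: Rogawski1990, §1.10] [cite: BorelJacquet1979, §4.1] -/
theorem archSectionE_archPart_mul (χ₁ : HeckeCharacter L) (χ₂ : ↥(TorusDict.torus (IsCMField.complexConj L)) →ₜ* ℂˣ)
    {b : (quasiSplit (↥(maximalRealSubfield L)) L (IsCMField.complexConj L) 3).Adelic} (hb : b ∈ borelAdelic (↥(maximalRealSubfield L)) L (IsCMField.complexConj L) 3)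
    (a : arch (↥(maximalRealSubfield L)) L (IsCMField.complexConj L) 3 ((StdForm.antidiagonal 3).over L)) :
    archSectionE L χ₁ χ₂ (archPart (↥(maximalRealSubfield L)) L (IsCMField.complexConj L) 3 ((StdForm.antidiagonal 3).over L) b * a) =
      (((χ₁ (firstEntryUnit (archToAdelic_archPart_mem_borelAdelic L hb)) : ℂˣ) : ℂ) * ((χ₂ (middleEntryUnitary (archToAdelic_archPart_mem_borelAdelic L hb)) : ℂˣ) : ℂ)) *
        archSectionE L χ₁ χ₂ a := by
  have key := lastRowChar_borel_mul_mul_adelicDet L χ₁ χ₂ (archToAdelic_archPart_mem_borelAdelic L hb)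
    (archToAdelic (↥(maximalRealSubfield L)) L (IsCMField.complexConj L) 3 ((StdForm.antidiagonal 3).over L) a) (archLastRowL L a)
  rw [← map_mul] at key
  rw [archSectionE_eq, archSectionE_eq, archLastRowL_archPart_mul L hb, key]

/-- **`Φa(1) = 1`** for the section of record — the letter `hΦa1` of ★ p863433. [folklore] -/
theorem archSectionE_one (χ₁ : HeckeCharacter L) (χ₂ : ↥(TorusDict.torus (IsCMField.complexConj L)) →ₜ* ℂˣ) : archSectionE L χ₁ χ₂ 1 = 1 := by
  have h1 : archToAdelic (↥(maximalRealSubfield L)) L (IsCMField.complexConj L) 3 ((StdForm.antidiagonal 3).over L) 1 = 1 := map_one _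
  have h2 : adelicDet (↥(maximalRealSubfield L)) L (IsCMField.complexConj L) 3 ((StdForm.antidiagonal 3).over L) (antidiagonal_over_det_ne_zero L 3)
      (archToAdelic (↥(maximalRealSubfield L)) L (IsCMField.complexConj L) 3 ((StdForm.antidiagonal 3).over L) 1) = 1 := by
    rw [h1]
    exact map_one _
  rw [archSectionE_eq, archLastRowL_one, lastRowChar_one, h2, map_one, Units.val_one, mul_one]

/-! ## §4 THE WITNESS OF RECORD — at a level, and hypothesis-free -/

/-- **THE NON-ZERO `(χ₁,χ₂)`-SECTION OF RECORD AT A LEVEL**: for ANY Hecke character `χ₁`, ANY character `χ₂` of `T(𝔸_{L⁺})`, and an open `K_f ≤ G(𝔸_f)` on whose Borel elements the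
pair character dies, `∃ K′ ω φ, φ ∈ chiSectionSpacePair χ₁ χ₂ K′ ω ∧ Continuous φ ∧ φ 1 ≠ 0` — `φ(g) = archSectionE(g_∞)·Φf(g_f)` (★ GLUE p863433, ★ `Φf` p863484, §2–§3).
[cite: BorelJacquet1979, §4.1] [cite: MoeglinWaldspurger1995, I.2.17] [cite: Rogawski1990, §1.10] -/
theorem exists_chiSectionPair_continuous_apply_one_ne_zero_of_level_E (χ₁ : HeckeCharacter L) (χ₂ : ↥(TorusDict.torus (IsCMField.complexConj L)) →ₜ* ℂˣ)
    (Kf : Subgroup ↥(finAdelic (↥(maximalRealSubfield L)) L (IsCMField.complexConj L) 3 ((StdForm.antidiagonal 3).over L)))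
    (hKo : IsOpen ((Kf : Subgroup ↥(finAdelic (↥(maximalRealSubfield L)) L (IsCMField.complexConj L) 3 ((StdForm.antidiagonal 3).over L))) :
      Set ↥(finAdelic (↥(maximalRealSubfield L)) L (IsCMField.complexConj L) 3 ((StdForm.antidiagonal 3).over L))))
    (hKχ : ∀ k ∈ Kf, ∀ (hk : finAdelicToAdelic (↥(maximalRealSubfield L)) L (IsCMField.complexConj L) 3 ((StdForm.antidiagonal 3).over L) k ∈
        borelAdelic (↥(maximalRealSubfield L)) L (IsCMField.complexConj L) 3),
      ((χ₁ (firstEntryUnit hk) : ℂˣ) : ℂ) * ((χ₂ (middleEntryUnitary hk) : ℂˣ) : ℂ) = 1) :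
    ∃ (K' : Subgroup (quasiSplit (↥(maximalRealSubfield L)) L (IsCMField.complexConj L) 3).Adelic) (ω : ↥K' →* ℂ)
      (φ : (quasiSplit (↥(maximalRealSubfield L)) L (IsCMField.complexConj L) 3).Adelic → ℂ),
      φ ∈ chiSectionSpacePair χ₁ χ₂ K' (ω : ↥K' → ℂ) ∧ Continuous φ ∧ φ 1 ≠ 0 := by
  classical
  obtain ⟨Φf, hΦfc, hΦfB, hΦfK, hΦf1⟩ := exists_finLevelSection L χ₁ χ₂ Kf hKo hKχ
  refine exists_chiSectionPair_continuous_apply_one_ne_zero_of_letters L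
    (fun b => if hb : b ∈ borelAdelic (↥(maximalRealSubfield L)) L (IsCMField.complexConj L) 3 then
      ((χ₁ (firstEntryUnit (archToAdelic_archPart_mem_borelAdelic L hb)) : ℂˣ) : ℂ) * ((χ₂ (middleEntryUnitary (archToAdelic_archPart_mem_borelAdelic L hb)) : ℂˣ) : ℂ)
      else 0)
    (fun b => if hb : b ∈ borelAdelic (↥(maximalRealSubfield L)) L (IsCMField.complexConj L) 3 then
      ((χ₁ (firstEntryUnit (finAdelicToAdelic_finPart_mem_borelAdelic L hb)) : ℂˣ) : ℂ) * ((χ₂ (middleEntryUnitary (finAdelicToAdelic_finPart_mem_borelAdelic L hb)) : ℂˣ) : ℂ)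
      else 0)
    (archSectionE L χ₁ χ₂) Φf Kf (fun b hb => ?_) (continuous_archSectionE L χ₁ χ₂) (fun b hb a => ?_) ?_ hΦfc (fun b hb u => ?_) hΦfK ?_
  · simp only [dif_pos hb]
    exact (borelPairChar_eq_arch_mul_fin L χ₁ χ₂ hb).symm
  · simp only [dif_pos hb]
    exact archSectionE_archPart_mul L χ₁ χ₂ hb a
  · rw [archSectionE_one]
    exact one_ne_zero
  · simp only [dif_pos hb]
    exact hΦfB b hb u
  · rw [hΦf1]
    exact one_ne_zero

/-- **THE NON-ZERO `(χ₁,χ₂)`-SECTION OF RECORD — HYPOTHESIS-FREE** ((V) discharge-table row (i), S8-R136 (3) ∕ S8-R178): for EVERY Hecke character `χ₁` of `L` and EVERY character `χ₂` of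
`T = U(1)(𝔸_{L⁺})`, **`∃ K′ ≤ G(𝔸), ω : K′ →* ℂ, φ ∈ chiSectionSpacePair χ₁ χ₂ K′ ω` continuous with `φ(1) ≠ 0`** (the level version at the ★ conductor level p863810
`exists_isOpen_level_borelPairChar_eq_one`). [cite: BorelJacquet1979, §4.1] [cite: MoeglinWaldspurger1995, I.2.17] [cite: Rogawski1990, §1.10] -/
theorem exists_chiSectionPair_continuous_apply_one_ne_zero_E (χ₁ : HeckeCharacter L) (χ₂ : ↥(TorusDict.torus (IsCMField.complexConj L)) →ₜ* ℂˣ) :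
    ∃ (K' : Subgroup (quasiSplit (↥(maximalRealSubfield L)) L (IsCMField.complexConj L) 3).Adelic) (ω : ↥K' →* ℂ)
      (φ : (quasiSplit (↥(maximalRealSubfield L)) L (IsCMField.complexConj L) 3).Adelic → ℂ),
      φ ∈ chiSectionSpacePair χ₁ χ₂ K' (ω : ↥K' → ℂ) ∧ Continuous φ ∧ φ 1 ≠ 0 := by
  obtain ⟨Kf, hKo, hKχ⟩ := exists_isOpen_level_borelPairChar_eq_one L χ₁ χ₂
  exact exists_chiSectionPair_continuous_apply_one_ne_zero_of_level_E L χ₁ χ₂ Kf hKo hKχ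

end Summit.HodgeConjecture.HodgeConjecture.R90.S8

end
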